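import Literature.Analysis.FluidPDE.KNSSTypeIRateVertexProofs
import HarnessLib

/-!
# KNSS 2009, proof of Theorem 6.2: the vertex estimate for PERTURBED Oseen representations
# (vanishing forcing / truncation errors)

Analysis/FluidPDE proof file (theorems only; no definitions, no named facts, no `sorry`).

The tree's `KNSS2009_typeI_rate_vertex_of_mild` (`KNSSTypeIRateVertexProofs.lean`; Koch–Nadirashvili–
Seregin–Šverák, Acta Math. 203 (2009) = arXiv:0709.3599, proof of Thm 6.2, last paragraph, p. 13)
proves the asymptotic equicontinuity of a blow-up sequence `w⁽ᵏ⁾` at the vertex from the EXACT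
representation formula `w⁽ᵏ⁾(t, 0) = e^{(t+1)Δ}w⁽ᵏ⁾(−1)(0) − B¹_{−1}(w⁽ᵏ⁾, w⁽ᵏ⁾)(t)(0)`. When the
`w⁽ᵏ⁾` are zooms of a FORCED solution, truncated in space, the representation holds only up to an
error `G_k(−1, t)(0)` which is small uniformly in `t ∈ (−1, 0]` (vanishing rescaled force, energy-paid
far field, heat commutator). This file records the same vertex estimate in that perturbed form:

* `knss_vertex_modulus_perturbed` — for fields `w_k` continuous on `(A_k, 0) × ℝ³` (`A_k → −∞`),
  bounded per `k`, with `M_k → ∞`, the datum bound `‖w_k(−1, ·)‖ ≤ C`, (wkbound) `‖w_k‖ ≤ K` off the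
  cylinder `{ρ_k ≤ M_k/2}` (`ρ_k(x) = cylRadius (x − single 0 (−M_k))`), (wkbound2)
  `‖w_k‖(M_k√(−τ) + ρ_k) ≤ K M_k` on `(−1, 0)`, and the perturbed representation at the vertex with
  `‖G_k(−1, t)(0)‖ ≤ η_k → 0` for `t ∈ (−1, 0]`: for every `ε > 0` there is `δ > 0` with
  `‖w_k(0, 0) − w_k(t, 0)‖ ≤ ε` for all large `k` and all `t ∈ [−δ, 0]`.

The proof is the tree's (caloric modulus `norm_heatExtension_sub_heatExtension_le_of_bound`, split of
the Duhamel term along the cylinder `oseenDuhamel_eq_add_of_indicator_compl`, off-cylinder modulus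
`exists_forall_norm_oseenDuhamel_sub_le`, cylinder integral `exists_norm_oseenDuhamel_cylinder_vertex_le`
= KNSS's `I(M) → 0`), plus the two perturbation terms. Consumer: the E–C endpoint seat's forced, local
version of KNSS Thm 6.2 (`Summits/NavierStokesRegularity/FluidComputer/ClayBlowupAxisZoomLimit.lean`).

## References

* G. Koch, N. Nadirashvili, G. Seregin, V. Šverák, *Liouville theorems for the Navier–Stokes equations
  and applications*, Acta Math. 203 (2009) 83–105 = arXiv:0709.3599: proof of Theorem 6.2, last
  paragraph, p. 13; (3.3), (3.8), pp. 6–7. [KochNadirashviliSereginSverak2009]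
-/

noncomputable section

open MeasureTheory Set Function Filter TopologicalSpace
open _root_.Topology
open scoped ENNReal NNReal

namespace Literature.Analysis.FluidPDE

/-- **KNSS 2009, proof of Theorem 6.2, the vertex estimate, perturbed representation.** Let
`C, K > 0`, `M_k > 0` with `M_k → ∞`, `A_k → −∞`, `η_k → 0`, and let `w_k : ℝ → ℝ³ → ℝ³` be continuous
on `(A_k, 0) × ℝ³`, bounded there per `k`, with `‖w_k(−1, ·)‖ ≤ C` (once `A_k < −1`), (wkbound)
`‖w_k(τ, x)‖ ≤ K` for `τ ∈ (A_k, 0)` off the cylinder `{cylRadius (x − single 0 (−M_k)) ≤ M_k/2}`,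
(wkbound2) `‖w_k(τ, x)‖ (M_k√(−τ) + cylRadius (x − single 0 (−M_k))) ≤ K M_k` for `τ ∈ (A_k, 0)`, and the
PERTURBED representation at the vertex
`w_k(t, 0) = e^{(t+1)Δ}w_k(−1)(0) − B¹_{−1}(w_k, w_k)(t)(0) + G_k(−1, t)(0)` with `‖G_k(−1,t)(0)‖ ≤ η_k`
for `−1 < t ≤ 0`. Then for every `ε > 0` there is `δ > 0` such that for all large `k` and all
`t ∈ [−δ, 0]`, `‖w_k(0, 0) − w_k(t, 0)‖ ≤ ε` (KNSS p. 13: "the only possible problem may occur due to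
the contribution from the cylinder `𝒞_k` … `I(M) → 0`").
[cite: KochNadirashviliSereginSverak2009, proof of Thm 6.2, last paragraph (arXiv p. 13)] -/
theorem knss_vertex_modulus_perturbed {C K : ℝ} (hC : 0 < C) (hK : 0 < K)
    {M A η : ℕ → ℝ}
    {w : ℕ → ℝ → EuclideanSpace ℝ (Fin 3) → EuclideanSpace ℝ (Fin 3)}
    {G : ℕ → ℝ → ℝ → EuclideanSpace ℝ (Fin 3) → EuclideanSpace ℝ (Fin 3)}
    (hMpos : ∀ k, 0 < M k) (hMlim : Tendsto M atTop atTop) (hAlim : Tendsto A atTop atBot)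
    (hη : Tendsto η atTop (𝓝 0))
    (hcont : ∀ k, ContinuousOn (uncurry (w k)) (Ioo (A k) 0 ×ˢ univ))
    (hL : ∀ k, ∃ L : ℝ, ∀ τ ∈ Ioo (A k) 0, ∀ x, ‖w k τ x‖ ≤ L)
    (hrep : ∀ k, A k < -1 → ∀ t : ℝ, -1 < t → t ≤ 0 →
      w k t 0 = UnboundedOperators.heatExtension (w k (-1)) (t - (-1)) 0 -
        oseenDuhamel 1 (-1) (w k) (w k) t 0 + G k (-1) t 0)
    (hG : ∀ k, A k < -1 → ∀ t : ℝ, -1 < t → t ≤ 0 → ‖G k (-1) t 0‖ ≤ η k)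
    (hdatum : ∀ k, A k < -1 → ∀ x, ‖w k (-1) x‖ ≤ C)
    (hoff : ∀ k, ∀ τ ∈ Ioo (A k) 0, ∀ x,
      M k / 2 < cylRadius (x - EuclideanSpace.single 0 (-M k)) → ‖w k τ x‖ ≤ K)
    (hmul : ∀ k, ∀ τ ∈ Ioo (A k) 0, ∀ x,
      ‖w k τ x‖ * (M k * Real.sqrt (-τ) + cylRadius (x - EuclideanSpace.single 0 (-M k))) ≤
        K * M k) :
    ∀ ε > 0, ∃ δ > 0, ∀ᶠ k in atTop, ∀ t ∈ Icc (-δ) 0, ‖w k 0 0 - w k t 0‖ ≤ ε := by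
  intro ε hε
  obtain ⟨C₂, hC₂, hcyl⟩ := exists_norm_oseenDuhamel_cylinder_vertex_le
  -- the heat modulus constant (dimension three, `τ₁ = 1/2`)
  set Kh : ℝ := (1 + 2 * (2 : ℝ) ^ ((Module.finrank ℝ (EuclideanSpace ℝ (Fin 3)) : ℝ) / 2)) *
    ((2 : ℝ) ^ ((Module.finrank ℝ (EuclideanSpace ℝ (Fin 3)) : ℝ) / 2) * ((1 / 2 : ℝ) / 2) ^ (-(1 / 2 : ℝ)) * C)
    with hKh
  have hKh0 : 0 ≤ Kh := by positivity
  -- `δ₁` for the caloric part, `δ₂` for the off-cylinder Duhamel part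
  set θ : ℝ := ε / 4 / (Kh + 1) with hθ
  have hθ0 : 0 < θ := by positivity
  set δ₁ : ℝ := min (1 / 2) (θ ^ 2) with hδ₁
  have hδ₁pos : 0 < δ₁ := lt_min (by norm_num) (by positivity)
  have hδ₁half : δ₁ ≤ 1 / 2 := min_le_left _ _
  obtain ⟨δ₂, hδ₂pos, hmod⟩ := exists_forall_norm_oseenDuhamel_sub_le (E := EuclideanSpace ℝ (Fin 3))
    one_pos one_pos hK.le (by positivity : (0 : ℝ) < ε / 4)
  refine ⟨min δ₁ δ₂, lt_min hδ₁pos hδ₂pos, ?_⟩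
  -- eventually `A_k < -1`, `C₂ K² / M_k ≤ ε / 8` and `η_k ≤ ε / 8`
  have hev1 : ∀ᶠ k in atTop, A k < -1 := hAlim.eventually_lt_atBot (-1)
  have hev2 : ∀ᶠ k in atTop, C₂ * K ^ 2 / M k ≤ ε / 8 := by
    filter_upwards [hMlim.eventually_ge_atTop (8 * C₂ * K ^ 2 / ε)] with k hk
    rw [div_le_iff₀ hε] at hk
    rw [div_le_iff₀ (hMpos k)]
    linarith
  have hev3 : ∀ᶠ k in atTop, η k ≤ ε / 8 :=
    (hη.eventually (eventually_le_nhds (show (0 : ℝ) < ε / 8 by positivity))).mono fun k hk => hk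
  filter_upwards [hev1, hev2, hev3] with k hk1 hk2 hk3 τ hτ
  have hτ0 : τ ≤ 0 := hτ.2
  have hτ1 : -δ₁ ≤ τ := le_trans (neg_le_neg (min_le_left δ₁ δ₂)) hτ.1
  have hτ2 : -δ₂ ≤ τ := le_trans (neg_le_neg (min_le_right δ₁ δ₂)) hτ.1
  have hτm : -1 < τ := by linarith
  have hMk := hMpos k
  set c : EuclideanSpace ℝ (Fin 3) := EuclideanSpace.single 0 (-M k) with hc
  set Cyl : Set (EuclideanSpace ℝ (Fin 3)) := {y | cylRadius (y - c) ≤ M k / 2} with hCyl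
  have hCylm : MeasurableSet Cyl := measurableSet_cylinder (M k)
  obtain ⟨L, hLk⟩ := hL k
  have hL0 : 0 ≤ L := (norm_nonneg _).trans (hLk (-1) ⟨hk1, by norm_num⟩ 0)
  -- the split of the Duhamel term along the cylinder
  set wc : ℝ → EuclideanSpace ℝ (Fin 3) → EuclideanSpace ℝ (Fin 3) := fun τ y => Cyl.indicator (w k τ) y
    with hwc
  set wo : ℝ → EuclideanSpace ℝ (Fin 3) → EuclideanSpace ℝ (Fin 3) := fun τ y => Cylᶜ.indicator (w k τ) y
    with hwo
  have hsplit : ∀ t : ℝ, -1 < t → t ≤ 0 →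
      oseenDuhamel 1 (-1) (w k) (w k) t 0 = oseenDuhamel 1 (-1) wc wc t 0 + oseenDuhamel 1 (-1) wo wo t 0 :=
    fun t ht1 ht0 => oseenDuhamel_eq_add_of_indicator_compl one_pos (hcont k) hk1.le ht0
      ht1 hL0 (fun τ' hτ' y => hLk τ' ⟨by linarith [hτ'.1], hτ'.2.trans_le ht0⟩ y) hCylm 0
  -- (1) the caloric part
  have hheat : ‖UnboundedOperators.heatExtension (w k (-1)) (0 - (-1)) 0 -
      UnboundedOperators.heatExtension (w k (-1)) (τ - (-1)) 0‖ ≤ ε / 4 := by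
    have hm1 : (-1 : ℝ) ∈ Ioo (A k) 0 := ⟨hk1, by norm_num⟩
    have hslice : Continuous (w k (-1)) :=
      (hcont k).comp_continuous (Continuous.prodMk_right (-1 : ℝ)) fun x => ⟨hm1, mem_univ x⟩
    have ham : AEStronglyMeasurable (w k (-1)) volume := hslice.aestronglyMeasurable
    have h := norm_heatExtension_sub_heatExtension_le_of_bound ham (hdatum k hk1) (τ₁ := 1 / 2)
      (τ := 1 + τ) (τ' := 1) (by norm_num) (by linarith) (by linarith) 0
    rw [show (1 : ℝ) - (1 + τ) = -τ by ring, ← Real.sqrt_eq_rpow] at h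
    rw [show (0 : ℝ) - (-1) = 1 by ring, show τ - (-1) = 1 + τ by ring]
    refine h.trans ?_
    change Kh * Real.sqrt (-τ) ≤ ε / 4
    have hs : Real.sqrt (-τ) ≤ θ := by
      calc Real.sqrt (-τ) ≤ Real.sqrt δ₁ := Real.sqrt_le_sqrt (by linarith)
        _ ≤ Real.sqrt (θ ^ 2) := Real.sqrt_le_sqrt (min_le_right _ _)
        _ = θ := Real.sqrt_sq hθ0.le
    calc Kh * Real.sqrt (-τ) ≤ Kh * θ := by gcongr
      _ = ε / 4 * (Kh / (Kh + 1)) := by rw [hθ]; field_simp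
      _ ≤ ε / 4 * 1 := by
          gcongr
          rw [div_le_one (by positivity)]; linarith
      _ = ε / 4 := mul_one _
  -- (2) the off-cylinder part
  have hoffp : ‖oseenDuhamel 1 (-1) wo wo 0 0 - oseenDuhamel 1 (-1) wo wo τ 0‖ ≤ ε / 4 := by
    have hwom : AEStronglyMeasurable (uncurry wo)
        ((volume : Measure (ℝ × EuclideanSpace ℝ (Fin 3))).restrict (Ioo (-1) 0 ×ˢ univ)) :=
      aestronglyMeasurable_uncurry_indicator_space (hcont k) hk1.le le_rfl hCylm.compl
    have hwoK : ∀ τ' ∈ Ioo (-1 : ℝ) 0, ∀ y, ‖wo τ' y‖ ≤ K := by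
      intro τ' hτ' y
      simp only [hwo]
      by_cases hy : y ∈ Cylᶜ
      · rw [indicator_of_mem hy]
        exact hoff k τ' ⟨by linarith [hτ'.1], hτ'.2⟩ y (lt_of_not_ge hy)
      · rw [indicator_of_notMem hy, norm_zero]; exact hK.le
    exact hmod (by norm_num) hwom hwom hwoK hwoK (by linarith) hτ0 le_rfl (by linarith) 0
  -- (3) the cylinder part
  have hcylp : ∀ t : ℝ, -1 < t → t ≤ 0 → ‖oseenDuhamel 1 (-1) wc wc t 0‖ ≤ ε / 8 := by
    intro t ht1 ht0
    have h := hcyl hK hMk (fun τ' hτ' y => hmul k τ' ⟨by linarith [hτ'.1], hτ'.2⟩ y) ht1 ht0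
    exact h.trans hk2
  -- (4) the perturbations
  have hG0 : ‖G k (-1) 0 0‖ ≤ ε / 8 := (hG k hk1 0 (by norm_num) le_rfl).trans hk3
  have hGτ : ‖G k (-1) τ 0‖ ≤ ε / 8 := (hG k hk1 τ hτm hτ0).trans hk3
  -- assemble
  set H0 := UnboundedOperators.heatExtension (w k (-1)) (0 - (-1)) 0 with hH0
  set Hτ := UnboundedOperators.heatExtension (w k (-1)) (τ - (-1)) 0 with hHτ
  set P0 := oseenDuhamel 1 (-1) wo wo 0 0 with hP0
  set Pτ := oseenDuhamel 1 (-1) wo wo τ 0 with hPτ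
  set Q0 := oseenDuhamel 1 (-1) wc wc 0 0 with hQ0
  set Qτ := oseenDuhamel 1 (-1) wc wc τ 0 with hQτ
  have hdec : w k 0 0 - w k τ 0 = (H0 - Hτ) - (P0 - Pτ) - Q0 + Qτ + G k (-1) 0 0 - G k (-1) τ 0 := by
    rw [hrep k hk1 0 (by norm_num) le_rfl, hrep k hk1 τ hτm hτ0, hsplit 0 (by norm_num) le_rfl,
      hsplit τ hτm hτ0]
    abel
  rw [hdec]
  calc ‖(H0 - Hτ) - (P0 - Pτ) - Q0 + Qτ + G k (-1) 0 0 - G k (-1) τ 0‖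
      ≤ ‖(H0 - Hτ) - (P0 - Pτ) - Q0 + Qτ + G k (-1) 0 0‖ + ‖G k (-1) τ 0‖ := norm_sub_le _ _
    _ ≤ ‖(H0 - Hτ) - (P0 - Pτ) - Q0 + Qτ‖ + ‖G k (-1) 0 0‖ + ‖G k (-1) τ 0‖ := by
        gcongr; exact norm_add_le _ _
    _ ≤ ‖(H0 - Hτ) - (P0 - Pτ) - Q0‖ + ‖Qτ‖ + ‖G k (-1) 0 0‖ + ‖G k (-1) τ 0‖ := by
        gcongr; exact norm_add_le _ _
    _ ≤ ‖(H0 - Hτ) - (P0 - Pτ)‖ + ‖Q0‖ + ‖Qτ‖ + ‖G k (-1) 0 0‖ + ‖G k (-1) τ 0‖ := by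
        gcongr; exact norm_sub_le _ _
    _ ≤ ‖H0 - Hτ‖ + ‖P0 - Pτ‖ + ‖Q0‖ + ‖Qτ‖ + ‖G k (-1) 0 0‖ + ‖G k (-1) τ 0‖ := by
        gcongr; exact norm_sub_le _ _
    _ ≤ ε / 4 + ε / 4 + ε / 8 + ε / 8 + ε / 8 + ε / 8 := by
        linarith [hheat, hoffp, hcylp 0 (by norm_num) le_rfl, hcylp τ hτm hτ0, hG0, hGτ]
    _ = ε := by ring

end Literature.Analysis.FluidPDE

end
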